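import Summits.Ventures.Crystal3D.Theorems.StickyWulffConstantGenericWallFloorDockedExact
import HarnessLib

/-!
# `DockedMenu` — the named statement (G-c′) «docked ⇒ menu» of lane G's ∀-filling glue
# (crux `GenericWallFloor`, stmt-Ventures-19480, line `WallLedgerG`; cf-p1 DECISION (xlii′) 2026-08-28T19:57Z)

HONEST FRAMING. Venture `Summits/Ventures/Crystal3D` (cell `crystal3d-full`), helper vocabulary for the crux `GenericWallFloor`
of `route-Ventures-StickyWulffConstant`, REGISTERED line `WallLedgerG`, open stub `stub_twoSlabAdhesion`.  DEFINITION ONLY (a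
named `Prop`, typed FIRST at the planner's request so that the G floor and cf-p2's §51 enumeration can cite it by name; the proof
`dockedMenu_holds` is the owner's next file).  Nothing is claimed here; F-C1 not moved.

THE STATEMENT.  The foreign-ball dichotomy (`unsaturated_near_or_docked_of_saturated`, `payer_near_or_docked_of_near_endBall`,
…SaturatedPocket/…DockedExact) leaves, besides payers, the DOCKED configurations: the end ball `z` touches a twelve-touched ball
`s` whose contacts are exactly a close-packed dozen `{s + B p : p ∈ P}` (`P` the fcc or the hcp kissing pattern).  `DockedMenu`
says that such a dozen is RIGID IN THE WALKING GRAIN'S FRAME `A` as soon as three slot neighbours `z + A wᵢ ∈ X` of `z`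
(`wᵢ ∈ fccSlots` linearly independent) touch `s`: the dozen of `s` is then the grain's own slot dozen `A(fccSlots)`, or one of
its eight TWIN DOZENS `{A w : ⟪A w, n⟫ ≤ 0} ∪ {A w − 2⟪A w, n⟫ n : ⟪A w, n⟫ < 0}` (`n` a unit `{111}` normal of the grain,
`⟪A w, n⟫ ∈ {0, ±√(2/3)}` — the currency of `hcpDozen_twin_of_three_independent` / `exit_twinCap_of_patch`).  Consequently
`s − z` and every contact of `s` lie in the finite MENU `z + (slot or twin vector) + (slot or twin vector)` of exact positions of
the grain — the universe of cf-p2's §51 classes; a docked configuration with a ball OFF that menu cannot share three independent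
touching slot neighbours.  The fcc-pattern half is already the theorem `docked_fcc_exact` (…DockedExact); the hcp-pattern half
(shared differences in one of the two fcc halves of the anticuboctahedron, or the mixed case via co-axiality) is (G-c″).
WHAT THIS IS NOT: no proof, no ledger, no enumeration; the three shared neighbours are a HYPOTHESIS (the walker's end certificate
`WalkCertified` supplies only the 5-slot closed vertex star of `−v`; classes with ≥ 8 exact contacts supply them by the count
`k + 5 − deg z ≥ 2…4`); F-C1 not moved.
-/

noncomputable section

namespace Summit.Ventures.Crystal3D.Theorems

open Literature.Geometry.DiscreteGeometry (fccKissingPattern hcpKissingPattern)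
open scoped InnerProductSpace

/-- **`DockedMenu` (lane G, item (G-c′) «docked ⇒ menu»).**  For every finite configuration `X`, grain frame `A`, balls
`z ∈ X` and `s` with `dist s z = 1` whose contacts in `X` all lie in a close-packed dozen `{s + B p : p ∈ P}` (`P` the fcc or
hcp kissing pattern, `B` a linear isometry), and every three linearly independent slots `w₁ w₂ w₃ ∈ fccSlots` with
`z + A wᵢ ∈ X` touching `s`: the dozen `B(P)` is the grain's slot dozen `A(fccSlots)`, or a twin dozen of the grain across a
unit `{111}` normal `n` (`⟪A w, n⟫ ∈ {0, ±√(2/3)}` for all slots): the nine slots with `⟪A w, n⟫ ≤ 0` and the three mirror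
images `A w − 2⟪A w, n⟫ n` of the slots with `⟪A w, n⟫ < 0`. -/
def DockedMenu : Prop :=
  ∀ (X : Finset (EuclideanSpace ℝ (Fin 3))) (A : EuclideanSpace ℝ (Fin 3) ≃ₗᵢ[ℝ] EuclideanSpace ℝ (Fin 3))
    (z s : EuclideanSpace ℝ (Fin 3)) (P : Finset (EuclideanSpace ℝ (Fin 3)))
    (B : EuclideanSpace ℝ (Fin 3) →ₗᵢ[ℝ] EuclideanSpace ℝ (Fin 3)),
    (P = fccKissingPattern ∨ P = hcpKissingPattern) → z ∈ X →
    (∀ q ∈ X, dist s q = 1 → ∃ p ∈ P, q = s + B p) → dist s z = 1 →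
    ∀ w₁ ∈ fccSlots, ∀ w₂ ∈ fccSlots, ∀ w₃ ∈ fccSlots, LinearIndependent ℝ ![w₁, w₂, w₃] →
      z + A w₁ ∈ X → z + A w₂ ∈ X → z + A w₃ ∈ X →
      dist s (z + A w₁) = 1 → dist s (z + A w₂) = 1 → dist s (z + A w₃) = 1 →
      B '' (↑P : Set (EuclideanSpace ℝ (Fin 3))) = A '' (↑fccSlots : Set (EuclideanSpace ℝ (Fin 3))) ∨
      ∃ n : EuclideanSpace ℝ (Fin 3), ‖n‖ = 1 ∧
        (∀ w ∈ fccSlots, ⟪A w, n⟫_ℝ = 0 ∨ ⟪A w, n⟫_ℝ = Real.sqrt (2 / 3) ∨ ⟪A w, n⟫_ℝ = -Real.sqrt (2 / 3)) ∧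
        B '' (↑P : Set (EuclideanSpace ℝ (Fin 3))) =
          (fun w => A w) '' {w | w ∈ fccSlots ∧ ⟪A w, n⟫_ℝ ≤ 0} ∪
            (fun w => A w - (2 * ⟪A w, n⟫_ℝ) • n) '' {w | w ∈ fccSlots ∧ ⟪A w, n⟫_ℝ < 0}

/-- **The fcc-pattern half of `DockedMenu` holds** (it is `docked_fcc_exact`): with an fcc docking dozen the first
alternative obtains. -/
theorem dockedMenu_fcc (X : Finset (EuclideanSpace ℝ (Fin 3))) (A : EuclideanSpace ℝ (Fin 3) ≃ₗᵢ[ℝ] EuclideanSpace ℝ (Fin 3))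
    {z s : EuclideanSpace ℝ (Fin 3)} (B : EuclideanSpace ℝ (Fin 3) →ₗᵢ[ℝ] EuclideanSpace ℝ (Fin 3)) (hz : z ∈ X)
    (hall : ∀ q ∈ X, dist s q = 1 → ∃ p ∈ fccKissingPattern, q = s + B p) (hsz : dist s z = 1)
    {w₁ w₂ w₃ : EuclideanSpace ℝ (Fin 3)} (hw₁ : w₁ ∈ fccSlots) (hw₂ : w₂ ∈ fccSlots) (hw₃ : w₃ ∈ fccSlots)
    (hind : LinearIndependent ℝ ![w₁, w₂, w₃]) (hX₁ : z + A w₁ ∈ X) (hX₂ : z + A w₂ ∈ X) (hX₃ : z + A w₃ ∈ X)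
    (hd₁ : dist s (z + A w₁) = 1) (hd₂ : dist s (z + A w₂) = 1) (hd₃ : dist s (z + A w₃) = 1) :
    B '' (↑fccKissingPattern : Set (EuclideanSpace ℝ (Fin 3))) = A '' (↑fccSlots : Set (EuclideanSpace ℝ (Fin 3))) :=
  (docked_fcc_exact A hz B hall hsz hw₁ hw₂ hw₃ hind hX₁ hX₂ hX₃ hd₁ hd₂ hd₃).1

end Summit.Ventures.Crystal3D.Theorems

end
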